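import Literature.NumberTheory.Transcendental.NesterenkoMultiplicityForms
import Literature.NumberTheory.Transcendental.NesterenkoEliminationLocalK
import HarnessLib

/-!
# Nesterenko's multiplicity estimate (LNM 1752 Ch. 10): Lemma 3.4 — proofs only

`Literature/NumberTheory/Transcendental/NesterenkoMultiplicityLemma34.lean` — proofs only (no
definitions, no named facts, nothing asserted). Part of the discharge of
`NesterenkoMultiplicity.NesterenkoPhilippon2001_ch10_thm_1_1` (Ch. 10 Theorem 1.1) along the printed
proof. Setting of Ch. 10 §2 (p. 153): `K = ℂ(z)` with `|α| = e^{−ord_{z=0} α}`, realised here in an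
arbitrary normed field `L ⊇ K` together with a `ℂ[z]`-algebra map `ι : ℂ⟦z⟧ → L` with
`‖ι φ‖ = e^{−ord φ}` (hypothesis `hι`); the point `ω̄ = (1, f₁, …, f_m)` is `omegaBar ι f`
(`NesterenkoMultiplicityForms.lean`) and `‖P‖_ω̄`, `|P|` are the tree's generic `NesterenkoK.normAt`,
`NesterenkoK.fieldNorm` (`NesterenkoEliminationLocalK.lean`).

* norms along `ω̄`: `norm_omegaBar` (`|ω̄| = 1`), `fieldNorm_toK_le_one` / `fieldNorm_toK_pos`
  (`0 < |P| ≤ 1` for `0 ≠ P ∈ ℂ[z][x̲]`), `normAt_X_zero` (`‖x₀‖_ω̄ = 1`),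
  `exp_neg_order_le_normAt` (`‖C‖_ω̄ ≥ |C(ω̄)| = e^{−ord E(z, f̄)}` for `C = x₀ⁿ E(x/x₀)`, p. 155);
* `affContr_ne_bot` — the affine trace `𝔞` of a non-zero homogeneous ideal is non-zero;
* **`lemma_3_4`** — LNM 1752 Ch. 10 Lemma 3.4 in the form its proof establishes it from (56): if every
  non-zero form `C ∈ 𝔭 ∩ ℂ[z, x̲]` has `‖C‖_ω̄ < e^{−c}` (`c` the constant of the `D`-property), then
  `x₀ ∉ 𝔭` and no non-zero homogeneous prime `𝔮 ⊆ 𝔭` has a `D`-stable affine trace ("`T𝔮 ⊂ 𝔮`" for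
  the homogenised operator `T` of p. 155 is, for `x₀ ∉ 𝔮`, `D`-stability of the ideal `𝔞` of the
  printed proof, `affContr 𝔮`). The hypothesis (56) is what Prop. 4.13 and Cor. 4.9 of Ch. 3 give
  from `log|𝔭(ω̄)| < −h(𝔭) − c m deg 𝔭`; that deduction is made where the lemma is applied.

## References

* [NesterenkoPhilippon2001] Yu. V. Nesterenko, P. Philippon (eds.), *Introduction to Algebraic
  Independence Theory*, LNM 1752, Springer 2001, Ch. 10 (Yu. V. Nesterenko) §3, Lemma 3.4 and its
  proof, (56)–(57) (pp. 155–156); §2 (p. 153); Ch. 3 §4 Def. 4.1, Example 1 (p. 37).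
-/

noncomputable section

open MvPolynomial
open scoped Polynomial

namespace Literature.NumberTheory.Transcendental

namespace NesterenkoMultiplicity

variable {m : ℕ}

/-! ## Lemma 3.4 of LNM 1752 Ch. 10 (p. 155) — proofs only

Setting: a normed field `L` containing `K = ℂ(z)` (as a `K`-algebra, compatibly with `ℂ[z]`)
and the power series `f_j` through a `ℂ[z]`-algebra map `ι : ℂ⟦z⟧ → L` realising the absolute
value `|α| = e^{−ord_{z=0} α}` of Ch. 10 §2 (p. 153): `‖ι φ‖ = e^{−ord φ}`.  The point
`ω̄ = (1, f₁, …, f_m)` is `omegaBar ι f`, and `‖P‖_ω̄` is the tree's generic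
`NesterenkoK.normAt` (`NesterenkoEliminationLocalK.lean`). -/

section Lemma34

open Literature.NumberTheory.Transcendental.NesterenkoK

attribute [local instance] MvPolynomial.gradedAlgebra

variable {L : Type*} [NormedField L] [Algebra ℂ[X] L] {ι : PowerSeries ℂ →ₐ[ℂ[X]] L}

/-- The hypothesis on `ι`: it realises `|φ| = e^{−ord φ}`. Under it, `‖ι φ‖ ≤ 1`. [folklore] -/
theorem norm_iota_le_one
    (hι : ∀ φ : PowerSeries ℂ, φ ≠ 0 → ‖ι φ‖ = Real.exp (-((φ.order).toNat : ℝ)))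
    (φ : PowerSeries ℂ) : ‖ι φ‖ ≤ 1 := by
  by_cases h : φ = 0
  · rw [h, map_zero, norm_zero]; exact zero_le_one
  · rw [hι φ h, Real.exp_le_one_iff]
    exact neg_nonpos.mpr (Nat.cast_nonneg _)

/-- `ι` is injective: `‖ι φ‖ > 0` for `φ ≠ 0`. [folklore] -/
theorem norm_iota_pos
    (hι : ∀ φ : PowerSeries ℂ, φ ≠ 0 → ‖ι φ‖ = Real.exp (-((φ.order).toNat : ℝ)))
    {φ : PowerSeries ℂ} (h : φ ≠ 0) : 0 < ‖ι φ‖ := by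
  rw [hι φ h]; exact Real.exp_pos _

/-- Polynomials `p(z)` have `|p| ≤ 1`. [cite: NesterenkoPhilippon2001, Ch. 3 Example 1 (p. 37)] -/
theorem norm_algebraMap_polynomial_le_one
    (hι : ∀ φ : PowerSeries ℂ, φ ≠ 0 → ‖ι φ‖ = Real.exp (-((φ.order).toNat : ℝ)))
    (p : ℂ[X]) : ‖algebraMap ℂ[X] L p‖ ≤ 1 := by
  rw [← ι.commutes p]
  exact norm_iota_le_one hι _

/-- Non-zero polynomials `p(z)` have `|p| > 0`. [folklore] -/
theorem norm_algebraMap_polynomial_pos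
    (hι : ∀ φ : PowerSeries ℂ, φ ≠ 0 → ‖ι φ‖ = Real.exp (-((φ.order).toNat : ℝ)))
    {p : ℂ[X]} (hp : p ≠ 0) : 0 < ‖algebraMap ℂ[X] L p‖ := by
  rw [← ι.commutes p]
  refine norm_iota_pos hι fun h => hp ?_
  have : ((p : PowerSeries ℂ)) = 0 := h
  exact_mod_cast this

/-- `|ω̄| = 1` for `ω̄ = (1, f₁, …, f_m)` (`|f_j| ≤ 1`). [cite: NesterenkoPhilippon2001, Ch. 10 §2 (p. 153)] -/
theorem norm_omegaBar
    (hι : ∀ φ : PowerSeries ℂ, φ ≠ 0 → ‖ι φ‖ = Real.exp (-((φ.order).toNat : ℝ)))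
    (f : Fin m → PowerSeries ℂ) : ‖omegaBar ι f‖ = 1 := by
  refine le_antisymm ?_ ?_
  · refine (pi_norm_le_iff_of_nonneg zero_le_one).mpr fun i => ?_
    refine Fin.cases ?_ (fun j => ?_) i
    · rw [omegaBar_zero, norm_one]
    · rw [omegaBar_succ]; exact norm_iota_le_one hι _
  · calc (1 : ℝ) = ‖omegaBar ι f 0‖ := by rw [omegaBar_zero, norm_one]
      _ ≤ ‖omegaBar ι f‖ := norm_le_pi_norm _ 0

/-- `|P| ≤ 1` for `P ∈ ℂ[z][x̲]` (all coefficients are polynomials in `z`).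
[cite: NesterenkoPhilippon2001, Ch. 3 Def. 4.1, Example 1 (p. 37)] -/
theorem fieldNorm_toK_le_one [Algebra (RatFunc ℂ) L] [IsScalarTower ℂ[X] (RatFunc ℂ) L]
    (hι : ∀ φ : PowerSeries ℂ, φ ≠ 0 → ‖ι φ‖ = Real.exp (-((φ.order).toNat : ℝ)))
    (C : Czx m) : fieldNorm L (toK C) ≤ 1 := by
  unfold fieldNorm Nesterenko.maxNorm
  have h : ((map (algebraMap (RatFunc ℂ) L) (toK C)).support.sup
      fun γ => ‖(map (algebraMap (RatFunc ℂ) L) (toK C)).coeff γ‖₊) ≤ 1 := by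
    refine Finset.sup_le fun γ _ => ?_
    rw [coeff_map, coeff_toK, ← IsScalarTower.algebraMap_apply]
    have := norm_algebraMap_polynomial_le_one hι (C.coeff γ)
    exact_mod_cast this
  exact_mod_cast h

/-- `|P| > 0` for `0 ≠ P ∈ ℂ[z][x̲]`. [folklore] -/
theorem fieldNorm_toK_pos [Algebra (RatFunc ℂ) L] [IsScalarTower ℂ[X] (RatFunc ℂ) L]
    (hι : ∀ φ : PowerSeries ℂ, φ ≠ 0 → ‖ι φ‖ = Real.exp (-((φ.order).toNat : ℝ)))
    {C : Czx m} (hC : C ≠ 0) : 0 < fieldNorm L (toK C) := by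
  obtain ⟨γ, hγ⟩ := MvPolynomial.ne_zero_iff.mp hC
  unfold fieldNorm
  refine lt_of_lt_of_le ?_ (Nesterenko.norm_coeff_le_maxNorm _ γ)
  rw [coeff_map, coeff_toK, ← IsScalarTower.algebraMap_apply]
  exact norm_algebraMap_polynomial_pos hι hγ

omit [Algebra ℂ[X] L] in
/-- `|x₀| = 1` over `L`. [folklore] -/
theorem fieldNorm_X_zero [Algebra (RatFunc ℂ) L] : fieldNorm L (X 0 : Kx m) = 1 := by
  unfold fieldNorm Nesterenko.maxNorm
  rw [map_X]
  have h : ((X (0 : Fin (m + 1)) : MvPolynomial (Fin (m + 1)) L).support.sup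
      fun γ => ‖(X (0 : Fin (m + 1)) : MvPolynomial (Fin (m + 1)) L).coeff γ‖₊) = 1 := by
    rw [support_X, Finset.sup_singleton, coeff_X, if_pos rfl, nnnorm_one]
  exact_mod_cast h

/-- **`‖x₀‖_ω̄ = 1`** ("Since `‖x₀‖_ω̄ = 1` one can conclude that `x₀ ∉ 𝔭`").
[cite: NesterenkoPhilippon2001, Ch. 10 Lemma 3.4, proof (p. 155)] -/
theorem normAt_X_zero [Algebra (RatFunc ℂ) L]
    (hι : ∀ φ : PowerSeries ℂ, φ ≠ 0 → ‖ι φ‖ = Real.exp (-((φ.order).toNat : ℝ)))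
    (f : Fin m → PowerSeries ℂ) : normAt (omegaBar ι f) (X 0 : Kx m) = 1 := by
  unfold normAt
  rw [fieldNorm_X_zero, norm_omegaBar hι, aeval_X, omegaBar_zero, norm_one, totalDegree_X]
  norm_num

/-- **`‖C‖_ω̄ ≥ |C(ω̄)| = e^{−ord E(z, f̄)}` for `C = x₀ⁿ E(x/x₀)`** (p. 155: "`‖C‖_ω̄ = |C(ω̄)|`";
here `≥`, the coefficients of `C` being polynomials in `z` of absolute value `≤ 1`).
[cite: NesterenkoPhilippon2001, Ch. 10 Lemma 3.4, proof, (57) (p. 155)] -/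
theorem exp_neg_order_le_normAt [Algebra ℂ L] [IsScalarTower ℂ ℂ[X] L] [Algebra (RatFunc ℂ) L]
    [IsScalarTower ℂ[X] (RatFunc ℂ) L]
    (hι : ∀ φ : PowerSeries ℂ, φ ≠ 0 → ‖ι φ‖ = Real.exp (-((φ.order).toNat : ℝ)))
    (f : Fin m → PowerSeries ℂ) {E : Rzx m} (hE : substSeries f E ≠ 0) (n : ℕ) :
    Real.exp (-(((substSeries f E).order).toNat : ℝ)) ≤
      normAt (omegaBar ι f) (toK (homogTo n E)) := by
  have hE0 : E ≠ 0 := fun h => hE (by rw [h, map_zero])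
  unfold normAt
  rw [norm_omegaBar hι, one_pow, mul_one, aeval_toK, aeval_omegaBar_homogTo, hι _ hE]
  have h := div_le_div_of_nonneg_left (Real.exp_pos (-(((substSeries f E).order).toNat : ℝ))).le
    (fieldNorm_toK_pos hι (homogTo_ne_zero n hE0)) (fieldNorm_toK_le_one hι (homogTo n E))
  rwa [div_one] at h

omit [NormedField L] [Algebra ℂ[X] L] in
/-- A non-zero element of a homogeneous ideal of `K[x̲]` has a non-zero homogeneous component in the
ideal. [folklore] -/
theorem exists_isHomogeneous_mem_ne_zero {𝔮 : Ideal (Kx m)}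
    (h𝔮 : 𝔮.IsHomogeneous (homogeneousSubmodule (Fin (m + 1)) (RatFunc ℂ))) (hne : 𝔮 ≠ ⊥) :
    ∃ P ∈ 𝔮, ∃ k : ℕ, P.IsHomogeneous k ∧ P ≠ 0 := by
  obtain ⟨P, hP, hP0⟩ := Submodule.exists_mem_ne_zero_of_ne_bot hne
  have hsum := MvPolynomial.sum_homogeneousComponent P
  have : ∃ k ∈ Finset.range (P.totalDegree + 1), homogeneousComponent k P ≠ 0 := by
    by_contra h
    push Not at h
    exact hP0 (by rw [← hsum]; exact Finset.sum_eq_zero h)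
  obtain ⟨k, -, hk⟩ := this
  refine ⟨homogeneousComponent k P, ?_, k, homogeneousComponent_isHomogeneous k P, hk⟩
  have e : (DirectSum.decompose (homogeneousSubmodule (Fin (m + 1)) (RatFunc ℂ)) P k :
      Kx m) = homogeneousComponent k P :=
    weightedDecomposition.decompose'_apply (RatFunc ℂ) (1 : Fin (m + 1) → ℕ) P k
  rw [← e]
  exact (h𝔮.mem_iff.mp hP) k

omit [NormedField L] [Algebra ℂ[X] L] in
/-- The affine trace of a non-zero homogeneous ideal is non-zero (clear denominators of a non-zero
form of `𝔮` and dehomogenise). [cite: NesterenkoPhilippon2001, Ch. 10 Lemma 3.4, proof (p. 155)] -/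
theorem affContr_ne_bot {𝔮 : Ideal (Kx m)}
    (h𝔮 : 𝔮.IsHomogeneous (homogeneousSubmodule (Fin (m + 1)) (RatFunc ℂ))) (hne : 𝔮 ≠ ⊥) :
    affContr 𝔮 ≠ ⊥ := by
  obtain ⟨P, hP, k, hPk, hP0⟩ := exists_isHomogeneous_mem_ne_zero h𝔮 hne
  obtain ⟨c, hc, E, hE, hEk⟩ := exists_toK_eq_C_mul_of_isHomogeneous hPk
  have hE0 : E ≠ 0 := by
    intro h
    rw [h, map_zero, eq_comm, mul_eq_zero] at hE
    rcases hE with h1 | h1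
    · exact ((map_ne_zero_iff _ (IsFractionRing.injective ℂ[X] (RatFunc ℂ))).mpr hc)
        (C_eq_zero.mp h1)
    · exact hP0 h1
  have hmem : dehomog E ∈ affContr 𝔮 := by
    refine ⟨k, xDegree_dehomog_le hEk, ?_⟩
    rw [homogTo_dehomog hEk, hE]
    exact 𝔮.mul_mem_left _ hP
  intro hbot
  rw [hbot, Ideal.mem_bot] at hmem
  exact hE0 (eq_zero_of_isHomogeneous_of_dehomog_eq_zero hEk hmem)

/-- **LNM 1752 Ch. 10 Lemma 3.4** (Nesterenko), in the form in which its proof uses the smallness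
hypothesis: let `f̄` have the `D`-property with the constant `c` and let `𝔭 ⊂ K[x̲]` be an ideal such
that every non-zero form `C ∈ 𝔭 ∩ ℂ[z, x̲]` has `‖C‖_ω̄ < e^{−c}` (this is (56), which the printed
proof derives from `log|𝔭(ω̄)| < −h(𝔭) − c m deg 𝔭` by Prop. 4.13 and Cor. 4.9 of Ch. 3). Then
`x₀ ∉ 𝔭`, and there is no non-zero homogeneous prime `𝔮 ⊆ 𝔭` "with `T𝔮 ⊂ 𝔮`", i.e. whose affine
trace `𝔞` (`affContr 𝔮`, the ideal of all `A` with `x₀^{deg A} A(z, x/x₀) ∈ 𝔮`) is stable under `D`: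
such an `𝔞` is prime and non-zero, so by the `D`-property it contains `E` with `ord E(z, f̄) ≤ c`,
and `C = x₀ⁿ E(x/x₀) ∈ 𝔮 ⊆ 𝔭` has `‖C‖_ω̄ ≥ |C(ω̄)| = e^{−ord E(z, f̄)} ≥ e^{−c}`, contradicting (56).
[cite: NesterenkoPhilippon2001, Ch. 10 Lemma 3.4 and its proof (pp. 155–156)] -/
theorem lemma_3_4 [Algebra ℂ L] [IsScalarTower ℂ ℂ[X] L] [Algebra (RatFunc ℂ) L]
    [IsScalarTower ℂ[X] (RatFunc ℂ) L]
    (hι : ∀ φ : PowerSeries ℂ, φ ≠ 0 → ‖ι φ‖ = Real.exp (-((φ.order).toNat : ℝ)))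
    (A : Fin (m + 1) → Rzx m) (f : Fin m → PowerSeries ℂ) {c : ℕ}
    (hD : ∀ 𝔞 : Ideal (Rzx m), 𝔞.IsPrime → 𝔞 ≠ ⊥ → IsDStable A 𝔞 →
      ∃ E ∈ 𝔞, (substSeries f E).order ≤ c)
    {𝔭 : Ideal (Kx m)}
    (h56 : ∀ (C : Czx m) (n : ℕ), C.IsHomogeneous n → C ≠ 0 → toK C ∈ 𝔭 →
      normAt (omegaBar ι f) (toK C) < Real.exp (-(c : ℝ))) :
    (X 0 : Kx m) ∉ 𝔭 ∧
      ∀ 𝔮 : Ideal (Kx m), 𝔮 ≤ 𝔭 → 𝔮.IsPrime → 𝔮 ≠ ⊥ →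
        𝔮.IsHomogeneous (homogeneousSubmodule (Fin (m + 1)) (RatFunc ℂ)) →
          ¬ IsDStable A (affContr 𝔮) := by
  have hc1 : Real.exp (-(c : ℝ)) ≤ 1 := by
    rw [Real.exp_le_one_iff]; exact neg_nonpos.mpr (Nat.cast_nonneg _)
  -- `x₀ ∉ 𝔭`
  have hx : (X 0 : Kx m) ∉ 𝔭 := by
    intro hx
    have h := h56 (X 0) 1 (isHomogeneous_X _ 0) (X_ne_zero 0) (by rwa [toK_X])
    rw [toK_X, normAt_X_zero hι] at h
    exact absurd (hc1.trans_lt h) (lt_irrefl _)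
  refine ⟨hx, fun 𝔮 hle hprime hne hhom hstab => ?_⟩
  have hx𝔮 : (X 0 : Kx m) ∉ 𝔮 := fun h => hx (hle h)
  haveI := hprime
  obtain ⟨E, hEmem, hord⟩ :=
    hD (affContr 𝔮) (isPrime_affContr hx𝔮) (affContr_ne_bot hhom hne) hstab
  obtain ⟨n, hn, hEn⟩ := hEmem
  have hsub : substSeries f E ≠ 0 := by
    intro h0
    rw [h0, PowerSeries.order_zero, top_le_iff] at hord
    exact ENat.coe_ne_top c hord
  have hE0 : E ≠ 0 := fun h => hsub (by rw [h, map_zero])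
  have hlt := h56 (homogTo n E) n (isHomogeneous_homogTo hn) (homogTo_ne_zero n hE0) (hle hEn)
  have hge := exp_neg_order_le_normAt hι f hsub n
  -- `e^{−c} ≤ e^{−ord E(z, f̄)}`
  have hmono : Real.exp (-(c : ℝ)) ≤ Real.exp (-(((substSeries f E).order).toNat : ℝ)) := by
    rw [Real.exp_le_exp, neg_le_neg_iff]
    have h1 : ((substSeries f E).order).toNat ≤ c := by
      have h2 : ((substSeries f E).order) ≤ c := hord
      have h3 := PowerSeries.coe_toNat_order hsub
      rw [← h3] at h2
      exact_mod_cast h2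
    exact_mod_cast h1
  exact absurd (hmono.trans hge) (not_le.mpr hlt)

end Lemma34

end NesterenkoMultiplicity

end Literature.NumberTheory.Transcendental

end
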